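import Summits.QuantumFields.YangMills.Theorems.UnitScaleTiltHistoryTailLaneTailChi
import Summits.QuantumFields.YangMills.Theorems.AlphaInputsT3ACv3RecordXChi
import HarnessLib

/-!
# Route `UnitScaleTilt` — crux `HistoryTailL` (stmt-QuantumFields-19936): THE CRUX FROM EACH χ-DISPLAY OF RECORD, BY NAME — cell `ym3-torus`, width seat `ym-ust-19936-w2` (g0)

WHAT THE KERNEL NOW SAYS, end to end.  The landed χ-consumer cone (`HistoryTailLaneTailChi.historyTailL_of_laneRecordsChi`, p572380: `(∀ L, Odd L → 1 < L →
AlphaInputsT3ACv3RecChi L) → HistoryTailL`) composed with the χ display knits — alpha-1's read-local `alphaInputsT3ACv3RecChi_of_pinnedPartsRecRChi` (p567805) and this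
seat's seam-blind `alphaInputsT3ACv3RecChi_of_pinnedPartsRecXChi` ∕ `alphaInputsT3ACv3RecChi_of_pinnedPartsRecFLChi` (p582171) — gives `HistoryTailL` from ONE displayed
predicate per odd block size `L > 1`:
* `historyTailL_of_pinnedPartsRecFLChi` — from the DISPLAY OF RECORD under OWNER DEPMAP v3.3: (T) [Balaban1985Variational] Thm 1 `Thm1GlobalMinAt` · the record sizes ·
  **(FL)** exact `k`-fold (0.4)-lifts of every charged datum with `B₃ε_W L^{−2k}`-regular finest plaquettes under `Ω_k(h)` · (O″χ) the χ data rows over the seam-blind class `𝒞_X`;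
* `historyTailL_of_pinnedPartsRecXChi` — the same with (D6X-CHARGED) in place of (FL);
* `historyTailL_of_pinnedPartsRecRChi` — the same over the read-local class `𝒞_R` with (D6R-CHARGED) (DEPMAP v3.2's display).
HONEST FRAMING.  Three one-line compositions of landed theorems; the displayed predicates are HYPOTHESIS SCHEMAS (never asserted) — this is «19936 PROVED MODULO the
display», not a proof of the crux; nothing of [Balaban1985UV3]'s cluster expansion or [Balaban1985Variational] Thm 1 is proved; count-neutral helper
(`--supports stmt-QuantumFields-19936`); registry untouched.  YM₃ on the torus is a RUNG of the programme, not the Clay problem; no claim about d = 4, infinite volume,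
or a mass gap.
[cite: Balaban1985UV3, (5) p.256, (47) p.267, (71) p.273 and Thm 2 p.272; Balaban1985Variational, Thm 1 (8) p.279; King1986, (3.12) p.657]
-/

namespace Summit.QuantumFields.YangMills.Theorems.HistoryTailLaneTailChi

/-- **`HistoryTailL` FROM THE (FL)-DISPLAY OF RECORD** (DEPMAP v3.3): if for every odd `L > 1` the displayed predicate `PinnedPartsT3ACRecFLChi L` holds — (T) + record sizes +
(FL) + (O″χ) over `𝒞_X` — then the crux holds (`historyTailL_of_laneRecordsChi ∘ alphaInputsT3ACv3RecChi_of_pinnedPartsRecFLChi`).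
[cite: Balaban1985UV3, (5) p.256, (47) p.267 and (71) p.273; Balaban1985Variational, Thm 1 (8) p.279] -/
theorem historyTailL_of_pinnedPartsRecFLChi
    (h : ∀ L : ℕ, Odd L → 1 < L → AlphaInputsT3AC.PinnedPartsT3ACRecFLChi L) :
    Summit.QuantumFields.YangMills.Theses.UnitScaleTilt.HistoryTailL :=
  historyTailL_of_laneRecordsChi fun L hLo hL => alphaInputsT3ACv3RecChi_of_pinnedPartsRecFLChi (h L hLo hL)

/-- **`HistoryTailL` FROM THE SEAM-BLIND (D6X-CHARGED)-DISPLAY**: the same through `alphaInputsT3ACv3RecChi_of_pinnedPartsRecXChi`.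
[cite: Balaban1985UV3, (5) p.256, (47) p.267 and (71) p.273; Balaban1985Variational, Thm 1 (8) p.279] -/
theorem historyTailL_of_pinnedPartsRecXChi
    (h : ∀ L : ℕ, Odd L → 1 < L → AlphaInputsT3AC.PinnedPartsT3ACRecXChi L) :
    Summit.QuantumFields.YangMills.Theses.UnitScaleTilt.HistoryTailL :=
  historyTailL_of_laneRecordsChi fun L hLo hL => alphaInputsT3ACv3RecChi_of_pinnedPartsRecXChi (h L hLo hL)

/-- **`HistoryTailL` FROM THE READ-LOCAL (D6R-CHARGED)-DISPLAY** (DEPMAP v3.2, alpha-1's `PinnedPartsT3ACRecRChi`): the same through `alphaInputsT3ACv3RecChi_of_pinnedPartsRecRChi`.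
[cite: Balaban1985UV3, (5) p.256, (47) p.267 and (71) p.273; Balaban1985Variational, Thm 1 (8) p.279] -/
theorem historyTailL_of_pinnedPartsRecRChi
    (h : ∀ L : ℕ, Odd L → 1 < L → AlphaInputsT3AC.PinnedPartsT3ACRecRChi L) :
    Summit.QuantumFields.YangMills.Theses.UnitScaleTilt.HistoryTailL :=
  historyTailL_of_laneRecordsChi fun L hLo hL => alphaInputsT3ACv3RecChi_of_pinnedPartsRecRChi (h L hLo hL)

end Summit.QuantumFields.YangMills.Theorems.HistoryTailLaneTailChi
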